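import Summits.QuantumFields.BalabanUV.Beta.D1BFx.TorusWeightMixedTerms

/-!
# TB4-W PART 3b-N (FILE N3c, part 2) — the word `W₄ = M₀ᵀ Ĉₛₜ M₀` of the mixed straight weight jet (road «BF-x», slot (K); ρ-g7-8, (S1))

Companion of `TorusWeightMixedTerms`: the SITE word `L̂ · Ĉₛₜ · L̂` (3a `Cjet₁₁ = −ĈLsq₁₁Ĉ + ĈLsqₛĈLsqₜĈ + ĈLsqₜĈLsqₛĈ`, `Lsq₁₁` four terms,
`Ljet₁₁ = [b = b′]·Ljet₂`) equals `perT (arr (Z4 …))` for the explicit s-dependent `ℤ⁴` site kernel `Z4` of FILE N3c §1 (six monomials,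
letters `W4_M1∕M2∕M4∕M5` of FILE N3b, torus test kept), hence **`W₄ = (arr s (K4 …))^`**, `K4 = dSw Z4`; plus `Loc Z4`.
[folklore] matrix∕array algebra; no definitions.
-/

noncomputable section

namespace Summit.QuantumFields.BalabanUV.Beta.D1BFx.TorusWeightMixedTermW4

open Matrix
open scoped BigOperators
open Literature.MathematicalPhysics.QuantumFieldTheory.Balaban1983to89
open Literature.MathematicalPhysics.QuantumFieldTheory.Balaban1983to89.Beta
open B12Sec2to5 (l1 l1_nonneg)
open ExpKernelCalculus (MKer BiLoc Decays Zl comp biLoc_comp_decays)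
open AffineAveraging (unitVec)
open BalabanStepJetsSucc (biLoc_comp_right)
open Summit.QuantumFields.BalabanUV.Beta.TameKernelCalculus (Loc decays_of_le biLoc_of_le trK)
open Summit.QuantumFields.BalabanUV.Beta.D1BFx.PeriodicArrays (arr toF decays_arr)
open Summit.QuantumFields.BalabanUV.Beta.D1BFx.FibredPeriodisation (periodiseF)
open Summit.QuantumFields.BalabanUV.Beta.D1BFx.GhostStencil (ghCur biLoc_ghCur)
open Summit.QuantumFields.BalabanUV.Beta.D1BFx.RJetProjector (Rgt decays_Rgt)
open Summit.QuantumFields.BalabanUV.Beta.D1BFx.RJetAssembly (dSw biLoc_dSw)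
open Summit.QuantumFields.BalabanUV.Beta.D1BFx.PeriodisedProjector (Lhat Shat)
open Summit.QuantumFields.BalabanUV.Beta.D1BFx.TorusHodgeWeight (Dhat)
open Summit.QuantumFields.BalabanUV.Beta.D1BFx.TorusGaugeWeight (Lhat_transpose)
open Summit.QuantumFields.BalabanUV.Beta.D1BFx.TorusCoframeJets (Djet Ljet Ljet₂ Ljet₁₁ Mjet₀ Mjet₁ Mjet₁₁ transpose_Ljet)
open Summit.QuantumFields.BalabanUV.Beta.D1BFx.TorusWeightJetsCombFree (Chat Cjet₁ Cjet₁₁ Lsq₁ Lsq₁₁ wgtMix)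
open Summit.QuantumFields.BalabanUV.Beta.D1BFx.TorusJetSandwichArrays (jetR jetC biLoc_jetR biLoc_jetC)
open Summit.QuantumFields.BalabanUV.Beta.D1BFx.TorusGhostWordArrays (perT lapU decays_lapU Lgh biLoc_Lgh cL Ljet_eq_perT Lsq_word_eq_perT)
open Summit.QuantumFields.BalabanUV.Beta.D1BFx.TorusGhostPairStencils (gh₂ biLoc_gh₂ biLoc_zero_of_nonneg)
open Summit.QuantumFields.BalabanUV.Beta.D1BFx.KGhostLeg (Cgh deltaCgh deltaCgh_pos decays_Cgh)
open Summit.QuantumFields.BalabanUV.Beta.D1BFx.KGhostLegJunction (Chat_eq_submatrix_periodiseF_Cgh)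
open Summit.QuantumFields.BalabanUV.Beta.D1BFx.TorusBondArrays (hat_arr_add hat_arr_sub hat_arr_neg hat_arr_smul Dhat_mul_perT_arr_mul_Dhat_transpose dB dB_pos
  dB_le_one dB_le_deltaCgh decays_lapU_Cgh decays_Cgh_lapU Lhat_Chat_Lhat_eq_perT perT_Cgh_mul_Lhat Lhat_mul_perT_Cgh)
open Summit.QuantumFields.BalabanUV.Beta.D1BFx.TorusWeightWordArrays (wL wR wC Ljet_Cgh_Lhat Lhat_Cgh_Ljet Lhat_Cgh_Lsq_Cgh_Lhat decays_Rgt_dB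
  Djet_Rhat_Dhat_transpose Dhat_Rhat_Djet_transpose)
open Summit.QuantumFields.BalabanUV.Beta.D1BFx.TorusTwoArrayWords (biLoc_comp_arr eYe biLoc_eYe Djet_mul_perT_mul_Djet_transpose)
open Summit.QuantumFields.BalabanUV.Beta.D1BFx.TorusMixedLetters (hat_arr_add_loc hat_arr_sub_loc hat_arr_zero hat_arr_ite transpose_hat_arr
  Djet_perT_arr_Dhat_transpose Dhat_perT_arr_Djet_transpose decays_Cgh_dB Ljet_Cgh_Ljet Lhat_Cgh_Ljet₁₁ Lhat_Cgh_Lsq_Cgh_Ljet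
  Lhat_mul_perT_A₂ decays_A₃ decays_A₄ Lhat_perT_Cgh_Lhat W4_M1 W4_M2 W4_M4 W4_M5)

open Summit.QuantumFields.BalabanUV.Beta.D1BFx.TorusWeightMixedTerms (Z4 K4 biLoc_wR)

section W4

variable (m : ℕ) {a : ℝ} (p : ℕ) [NeZero p] {ρ : Type*} [Fintype ρ] [DecidableEq ρ] (κ : Fin 4) (u : Fin 4 → ℤ) (l : Fin 4) (u' : Fin 4 → ℤ)

/-- [folklore] `perT (arr (V + W)) = perT (arr V) + perT (arr W)` for localised `V`, `W`. -/
theorem perT_arr_add_loc (s : ℕ) [NeZero s] {V W : MKer 4 Unit} (hV : Loc V) (hW : Loc W) :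
    perT s (arr s (V + W)) = perT s (arr s V) + perT s (arr s W) := by
  rw [perT, hat_arr_add_loc s hV hW]; rfl

/-- [folklore] `perT (arr (−V)) = −perT (arr V)`. -/
theorem perT_arr_neg (s : ℕ) [NeZero s] (V : MKer 4 Unit) : perT s (arr s (-V)) = -perT s (arr s V) := by
  rw [perT, hat_arr_neg]; rfl

/-- [folklore] `perT (arr (if P then K else 0)) = if P then perT (arr K) else 0`. -/
theorem perT_arr_ite (s : ℕ) [NeZero s] (Q : Prop) [Decidable Q] (K : MKer 4 Unit) :
    perT s (arr s (if Q then K else 0)) = if Q then perT s (arr s K) else 0 := by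
  split_ifs
  · rfl
  · rw [perT, hat_arr_zero]; rfl

/-- [folklore] **THE SITE WORD OF `W₄`**: `L̂ · Ĉₛₜ · L̂ = perT (arr (Z4 s (m+1) a κ u l u′))` over any basis `N` of `ker Ŝ`. -/
theorem W4_site (ha : 0 < a) {N : Matrix (Site 4 ((m + 1) * p)) ρ ℝ}
    (hN : ∀ lam : Site 4 ((m + 1) * p) → ℝ, Shat m ((m + 1) * p) *ᵥ lam = 0 ↔ ∃ c : ρ → ℝ, lam = N *ᵥ c)
    (hNinj : Function.Injective N.mulVec) :
    Lhat ((m + 1) * p) * Cjet₁₁ ((m + 1) * p) (siteOf 4 ((m + 1) * p) u, κ) (siteOf 4 ((m + 1) * p) u', l) N * Lhat ((m + 1) * p) = perT ((m + 1) * p) (arr ((m + 1) * p) (Z4 ((m + 1) * p) (m + 1) a κ u l u')) := by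
  have hd := dB_pos (m + 1) a ha
  obtain ⟨C₁, hC₁⟩ := decays_lapU_Cgh (m + 1) a ha
  obtain ⟨C₂, hC₂⟩ := decays_Cgh_lapU (m + 1) a ha
  obtain ⟨C₃, hC₃⟩ := decays_A₃ m ha
  obtain ⟨C₄, hC₄⟩ := decays_A₄ m ha
  obtain ⟨C, hC⟩ := decays_Cgh_dB m ha
  obtain ⟨CR, -, hR⟩ := biLoc_wR m ha
  have hCh : Chat ((m + 1) * p) N = perT ((m + 1) * p) (Cgh (m + 1) a) := Chat_eq_submatrix_periodiseF_Cgh m p ha hN hNinj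
  -- localisation of the six pieces (TA2 linearity)
  have sA₁ : TameKernelCalculus.Spr (comp lapU (Cgh (m + 1) a)) := ⟨_, _, half_pos hd, hC₁⟩
  have sA₂ : TameKernelCalculus.Spr (comp (Cgh (m + 1) a) lapU) := ⟨_, _, half_pos hd, hC₂⟩
  have sA₃ : TameKernelCalculus.Spr (comp lapU (comp (Cgh (m + 1) a) lapU)) := ⟨_, _, by linarith, hC₃⟩
  have sA₄ : TameKernelCalculus.Spr (comp (comp lapU (Cgh (m + 1) a)) lapU) := ⟨_, _, by linarith, hC₄⟩
  have sC : TameKernelCalculus.Spr (Cgh (m + 1) a) := ⟨_, _, half_pos hd, hC⟩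
  have lg : Loc (gh₂ κ u) := ⟨u, u, _, 1, one_pos, biLoc_gh₂ κ u 1⟩
  have lG : ∀ (κ : Fin 4) (u : Fin 4 → ℤ), Loc (Lgh κ u) := fun κ u => ⟨u, u, _, _, by norm_num, biLoc_Lgh κ u⟩
  have lR : ∀ (κ : Fin 4) (u : Fin 4 → ℤ), Loc (wR (m + 1) a κ u) := fun κ u => ⟨u, u, _, _, by linarith, hR κ u⟩
  have LM1 : Loc (comp (comp (comp lapU (Cgh (m + 1) a)) (gh₂ κ u)) (comp lapU (comp (Cgh (m + 1) a) lapU))) := (sA₁.comp_loc lg).comp_spr sA₃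
  have LM4 : Loc (comp (comp (comp (comp lapU (Cgh (m + 1) a)) lapU) (gh₂ κ u)) (comp (Cgh (m + 1) a) lapU)) := (sA₄.comp_loc lg).comp_spr sA₂
  have LM2 : Loc (comp (comp (wR (m + 1) a κ u) (arr ((m + 1) * p) (ghCur l u'))) (comp (Cgh (m + 1) a) lapU)) := ((lR κ u).comp_spr (PeriodicArrays.spr_arr (biLoc_ghCur l u' 1) one_pos ((m + 1) * p))).comp_spr sA₂
  have LM3 : Loc (comp (comp (wR (m + 1) a l u') (arr ((m + 1) * p) (ghCur κ u))) (comp (Cgh (m + 1) a) lapU)) := ((lR l u').comp_spr (PeriodicArrays.spr_arr (biLoc_ghCur κ u 1) one_pos ((m + 1) * p))).comp_spr sA₂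
  have LM5 : Loc (comp (comp (comp (comp (comp lapU (Cgh (m + 1) a)) (Lgh κ u)) (Cgh (m + 1) a)) (arr ((m + 1) * p) (Lgh l u'))) (comp (Cgh (m + 1) a) lapU)) :=
    ((((sA₁.comp_loc (lG κ u)).comp_spr sC).comp_spr (PeriodicArrays.spr_arr (biLoc_Lgh l u') (by norm_num) ((m + 1) * p))).comp_spr sA₂)
  have LM6 : Loc (comp (comp (comp (comp (comp lapU (Cgh (m + 1) a)) (Lgh l u')) (Cgh (m + 1) a)) (arr ((m + 1) * p) (Lgh κ u))) (comp (Cgh (m + 1) a) lapU)) :=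
    ((((sA₁.comp_loc (lG l u')).comp_spr sC).comp_spr (PeriodicArrays.spr_arr (biLoc_Lgh κ u) (by norm_num) ((m + 1) * p))).comp_spr sA₂)
  -- the letters in the grouping of the expansion
  have hM1 : Lhat ((m + 1) * p) * perT ((m + 1) * p) (Cgh (m + 1) a) * Ljet₂ ((m + 1) * p) (siteOf 4 ((m + 1) * p) u, κ) * (Lhat ((m + 1) * p) * (perT ((m + 1) * p) (Cgh (m + 1) a) * Lhat ((m + 1) * p))) = perT ((m + 1) * p) (arr ((m + 1) * p) (comp (comp (comp lapU (Cgh (m + 1) a)) (gh₂ κ u)) (comp lapU (comp (Cgh (m + 1) a) lapU)))) := by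
    rw [perT_Cgh_mul_Lhat a m p ha]; exact W4_M1 m p κ u ha
  have hM2 : Lhat ((m + 1) * p) * perT ((m + 1) * p) (Cgh (m + 1) a) * Ljet ((m + 1) * p) (siteOf 4 ((m + 1) * p) u, κ) * Ljet ((m + 1) * p) (siteOf 4 ((m + 1) * p) u', l) * (perT ((m + 1) * p) (Cgh (m + 1) a) * Lhat ((m + 1) * p)) = perT ((m + 1) * p) (arr ((m + 1) * p) (comp (comp (wR (m + 1) a κ u) (arr ((m + 1) * p) (ghCur l u'))) (comp (Cgh (m + 1) a) lapU))) := W4_M2 m p κ u l u' ha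
  have hM3 : Lhat ((m + 1) * p) * perT ((m + 1) * p) (Cgh (m + 1) a) * Ljet ((m + 1) * p) (siteOf 4 ((m + 1) * p) u', l) * Ljet ((m + 1) * p) (siteOf 4 ((m + 1) * p) u, κ) * (perT ((m + 1) * p) (Cgh (m + 1) a) * Lhat ((m + 1) * p)) = perT ((m + 1) * p) (arr ((m + 1) * p) (comp (comp (wR (m + 1) a l u') (arr ((m + 1) * p) (ghCur κ u))) (comp (Cgh (m + 1) a) lapU))) := W4_M2 m p l u' κ u ha
  have hM4 : Lhat ((m + 1) * p) * perT ((m + 1) * p) (Cgh (m + 1) a) * Lhat ((m + 1) * p) * Ljet₂ ((m + 1) * p) (siteOf 4 ((m + 1) * p) u, κ) * (perT ((m + 1) * p) (Cgh (m + 1) a) * Lhat ((m + 1) * p)) = perT ((m + 1) * p) (arr ((m + 1) * p) (comp (comp (comp (comp lapU (Cgh (m + 1) a)) lapU) (gh₂ κ u)) (comp (Cgh (m + 1) a) lapU))) := W4_M4 m p κ u ha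
  have hM5 : Lhat ((m + 1) * p) * perT ((m + 1) * p) (Cgh (m + 1) a) * perT ((m + 1) * p) (arr ((m + 1) * p) (Lgh κ u)) * perT ((m + 1) * p) (Cgh (m + 1) a) * perT ((m + 1) * p) (arr ((m + 1) * p) (Lgh l u')) * (perT ((m + 1) * p) (Cgh (m + 1) a) * Lhat ((m + 1) * p)) = perT ((m + 1) * p) (arr ((m + 1) * p) (comp (comp (comp (comp (comp lapU (Cgh (m + 1) a)) (Lgh κ u)) (Cgh (m + 1) a)) (arr ((m + 1) * p) (Lgh l u'))) (comp (Cgh (m + 1) a) lapU))) := by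
    rw [← Lsq_word_eq_perT ((m + 1) * p) κ u, ← Lsq_word_eq_perT ((m + 1) * p) l u']; exact W4_M5 m p κ u l u' ha
  have hM6 : Lhat ((m + 1) * p) * perT ((m + 1) * p) (Cgh (m + 1) a) * perT ((m + 1) * p) (arr ((m + 1) * p) (Lgh l u')) * perT ((m + 1) * p) (Cgh (m + 1) a) * perT ((m + 1) * p) (arr ((m + 1) * p) (Lgh κ u)) * (perT ((m + 1) * p) (Cgh (m + 1) a) * Lhat ((m + 1) * p)) = perT ((m + 1) * p) (arr ((m + 1) * p) (comp (comp (comp (comp (comp lapU (Cgh (m + 1) a)) (Lgh l u')) (Cgh (m + 1) a)) (arr ((m + 1) * p) (Lgh κ u))) (comp (Cgh (m + 1) a) lapU))) := by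
    rw [← Lsq_word_eq_perT ((m + 1) * p) κ u, ← Lsq_word_eq_perT ((m + 1) * p) l u']; exact W4_M5 m p l u' κ u ha
  have hG : Lsq₁ ((m + 1) * p) (siteOf 4 ((m + 1) * p) u, κ) = perT ((m + 1) * p) (arr ((m + 1) * p) (Lgh κ u)) := by rw [Lsq₁]; exact Lsq_word_eq_perT ((m + 1) * p) κ u
  have hG' : Lsq₁ ((m + 1) * p) (siteOf 4 ((m + 1) * p) u', l) = perT ((m + 1) * p) (arr ((m + 1) * p) (Lgh l u')) := by rw [Lsq₁]; exact Lsq_word_eq_perT ((m + 1) * p) l u'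
  have Lite : Loc (if (siteOf 4 ((m + 1) * p) u, κ) = (siteOf 4 ((m + 1) * p) u', l) then comp (comp (comp lapU (Cgh (m + 1) a)) (gh₂ κ u)) (comp lapU (comp (Cgh (m + 1) a) lapU)) + comp (comp (comp (comp lapU (Cgh (m + 1) a)) lapU) (gh₂ κ u)) (comp (Cgh (m + 1) a) lapU) else 0) := by
    split_ifs
    · exact LM1.add LM4
    · exact ⟨u, u, 0, 1, one_pos, biLoc_zero_of_nonneg u u le_rfl 1⟩
  have Lin := (Lite.add LM2).add LM3
  rw [Cjet₁₁, Lsq₁₁, hCh, hG, hG', Z4, perT_arr_add_loc _ (Lin.neg.add LM5) LM6, perT_arr_add_loc _ Lin.neg LM5, perT_arr_neg,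
    perT_arr_add_loc _ (Lite.add LM2) LM3, perT_arr_add_loc _ Lite LM2, perT_arr_ite]
  by_cases ht : (siteOf 4 ((m + 1) * p) u, κ) = (siteOf 4 ((m + 1) * p) u', l)
  · rw [if_pos ht, perT_arr_add_loc _ LM1 LM4, Ljet₁₁, if_pos ht]
    have e2 : Lhat ((m + 1) * p) * (-(perT ((m + 1) * p) (Cgh (m + 1) a) * (Ljet₂ ((m + 1) * p) (siteOf 4 ((m + 1) * p) u, κ) * Lhat ((m + 1) * p) + Ljet ((m + 1) * p) (siteOf 4 ((m + 1) * p) u, κ) * Ljet ((m + 1) * p) (siteOf 4 ((m + 1) * p) u', l) + Ljet ((m + 1) * p) (siteOf 4 ((m + 1) * p) u', l) * Ljet ((m + 1) * p) (siteOf 4 ((m + 1) * p) u, κ) + Lhat ((m + 1) * p) * Ljet₂ ((m + 1) * p) (siteOf 4 ((m + 1) * p) u, κ)) * perT ((m + 1) * p) (Cgh (m + 1) a))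
          + perT ((m + 1) * p) (Cgh (m + 1) a) * perT ((m + 1) * p) (arr ((m + 1) * p) (Lgh κ u)) * perT ((m + 1) * p) (Cgh (m + 1) a) * perT ((m + 1) * p) (arr ((m + 1) * p) (Lgh l u')) * perT ((m + 1) * p) (Cgh (m + 1) a) + perT ((m + 1) * p) (Cgh (m + 1) a) * perT ((m + 1) * p) (arr ((m + 1) * p) (Lgh l u')) * perT ((m + 1) * p) (Cgh (m + 1) a) * perT ((m + 1) * p) (arr ((m + 1) * p) (Lgh κ u)) * perT ((m + 1) * p) (Cgh (m + 1) a)) * Lhat ((m + 1) * p)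
        = -(Lhat ((m + 1) * p) * perT ((m + 1) * p) (Cgh (m + 1) a) * Ljet₂ ((m + 1) * p) (siteOf 4 ((m + 1) * p) u, κ) * (Lhat ((m + 1) * p) * (perT ((m + 1) * p) (Cgh (m + 1) a) * Lhat ((m + 1) * p))) + Lhat ((m + 1) * p) * perT ((m + 1) * p) (Cgh (m + 1) a) * Ljet ((m + 1) * p) (siteOf 4 ((m + 1) * p) u, κ) * Ljet ((m + 1) * p) (siteOf 4 ((m + 1) * p) u', l) * (perT ((m + 1) * p) (Cgh (m + 1) a) * Lhat ((m + 1) * p))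
            + Lhat ((m + 1) * p) * perT ((m + 1) * p) (Cgh (m + 1) a) * Ljet ((m + 1) * p) (siteOf 4 ((m + 1) * p) u', l) * Ljet ((m + 1) * p) (siteOf 4 ((m + 1) * p) u, κ) * (perT ((m + 1) * p) (Cgh (m + 1) a) * Lhat ((m + 1) * p)) + Lhat ((m + 1) * p) * perT ((m + 1) * p) (Cgh (m + 1) a) * Lhat ((m + 1) * p) * Ljet₂ ((m + 1) * p) (siteOf 4 ((m + 1) * p) u, κ) * (perT ((m + 1) * p) (Cgh (m + 1) a) * Lhat ((m + 1) * p)))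
          + Lhat ((m + 1) * p) * perT ((m + 1) * p) (Cgh (m + 1) a) * perT ((m + 1) * p) (arr ((m + 1) * p) (Lgh κ u)) * perT ((m + 1) * p) (Cgh (m + 1) a) * perT ((m + 1) * p) (arr ((m + 1) * p) (Lgh l u')) * (perT ((m + 1) * p) (Cgh (m + 1) a) * Lhat ((m + 1) * p)) + Lhat ((m + 1) * p) * perT ((m + 1) * p) (Cgh (m + 1) a) * perT ((m + 1) * p) (arr ((m + 1) * p) (Lgh l u')) * perT ((m + 1) * p) (Cgh (m + 1) a) * perT ((m + 1) * p) (arr ((m + 1) * p) (Lgh κ u)) * (perT ((m + 1) * p) (Cgh (m + 1) a) * Lhat ((m + 1) * p)) := by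
      simp only [Matrix.mul_add, Matrix.add_mul, Matrix.mul_neg, Matrix.neg_mul, Matrix.mul_assoc]
    rw [e2, hM1, hM2, hM3, hM4, hM5, hM6]
    abel
  · rw [if_neg ht, Ljet₁₁, if_neg ht]
    have e2 : Lhat ((m + 1) * p) * (-(perT ((m + 1) * p) (Cgh (m + 1) a) * (0 * Lhat ((m + 1) * p) + Ljet ((m + 1) * p) (siteOf 4 ((m + 1) * p) u, κ) * Ljet ((m + 1) * p) (siteOf 4 ((m + 1) * p) u', l) + Ljet ((m + 1) * p) (siteOf 4 ((m + 1) * p) u', l) * Ljet ((m + 1) * p) (siteOf 4 ((m + 1) * p) u, κ) + Lhat ((m + 1) * p) * 0) * perT ((m + 1) * p) (Cgh (m + 1) a))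
          + perT ((m + 1) * p) (Cgh (m + 1) a) * perT ((m + 1) * p) (arr ((m + 1) * p) (Lgh κ u)) * perT ((m + 1) * p) (Cgh (m + 1) a) * perT ((m + 1) * p) (arr ((m + 1) * p) (Lgh l u')) * perT ((m + 1) * p) (Cgh (m + 1) a) + perT ((m + 1) * p) (Cgh (m + 1) a) * perT ((m + 1) * p) (arr ((m + 1) * p) (Lgh l u')) * perT ((m + 1) * p) (Cgh (m + 1) a) * perT ((m + 1) * p) (arr ((m + 1) * p) (Lgh κ u)) * perT ((m + 1) * p) (Cgh (m + 1) a)) * Lhat ((m + 1) * p)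
        = -(Lhat ((m + 1) * p) * perT ((m + 1) * p) (Cgh (m + 1) a) * Ljet ((m + 1) * p) (siteOf 4 ((m + 1) * p) u, κ) * Ljet ((m + 1) * p) (siteOf 4 ((m + 1) * p) u', l) * (perT ((m + 1) * p) (Cgh (m + 1) a) * Lhat ((m + 1) * p)) + Lhat ((m + 1) * p) * perT ((m + 1) * p) (Cgh (m + 1) a) * Ljet ((m + 1) * p) (siteOf 4 ((m + 1) * p) u', l) * Ljet ((m + 1) * p) (siteOf 4 ((m + 1) * p) u, κ) * (perT ((m + 1) * p) (Cgh (m + 1) a) * Lhat ((m + 1) * p)))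
          + Lhat ((m + 1) * p) * perT ((m + 1) * p) (Cgh (m + 1) a) * perT ((m + 1) * p) (arr ((m + 1) * p) (Lgh κ u)) * perT ((m + 1) * p) (Cgh (m + 1) a) * perT ((m + 1) * p) (arr ((m + 1) * p) (Lgh l u')) * (perT ((m + 1) * p) (Cgh (m + 1) a) * Lhat ((m + 1) * p)) + Lhat ((m + 1) * p) * perT ((m + 1) * p) (Cgh (m + 1) a) * perT ((m + 1) * p) (arr ((m + 1) * p) (Lgh l u')) * perT ((m + 1) * p) (Cgh (m + 1) a) * perT ((m + 1) * p) (arr ((m + 1) * p) (Lgh κ u)) * (perT ((m + 1) * p) (Cgh (m + 1) a) * Lhat ((m + 1) * p)) := by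
      simp only [Matrix.zero_mul, Matrix.mul_zero, zero_add, add_zero, Matrix.mul_add, Matrix.add_mul, Matrix.mul_neg, Matrix.neg_mul,
        Matrix.mul_assoc]
    rw [e2, hM2, hM3, hM5, hM6]
    abel

/-- [folklore] **`Z4` IS LOCALISED** (for every `s`; TA2 linearity and the bond sandwich need it): built from the `Loc`∕`Spr` calculus of
`TameKernelCalculus` over the decaying legs `A₁ A₂ A₃ A₄ Cgh`, the stencils `gh₂`, `ghCur`, `Lgh`, FILE N2's `wR` and TA2's `spr_arr`. -/
theorem loc_Z4 (ha : 0 < a) : Loc (Z4 ((m + 1) * p) (m + 1) a κ u l u') := by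
  have hd := dB_pos (m + 1) a ha
  obtain ⟨C₁, hC₁⟩ := decays_lapU_Cgh (m + 1) a ha
  obtain ⟨C₂, hC₂⟩ := decays_Cgh_lapU (m + 1) a ha
  obtain ⟨C₃, hC₃⟩ := decays_A₃ m ha
  obtain ⟨C₄, hC₄⟩ := decays_A₄ m ha
  obtain ⟨C, hC⟩ := decays_Cgh_dB m ha
  obtain ⟨CR, -, hR⟩ := biLoc_wR m ha
  have sA₁ : TameKernelCalculus.Spr (comp lapU (Cgh (m + 1) a)) := ⟨_, _, half_pos hd, hC₁⟩
  have sA₂ : TameKernelCalculus.Spr (comp (Cgh (m + 1) a) lapU) := ⟨_, _, half_pos hd, hC₂⟩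
  have sA₃ : TameKernelCalculus.Spr (comp lapU (comp (Cgh (m + 1) a) lapU)) := ⟨_, _, by linarith, hC₃⟩
  have sA₄ : TameKernelCalculus.Spr (comp (comp lapU (Cgh (m + 1) a)) lapU) := ⟨_, _, by linarith, hC₄⟩
  have sC : TameKernelCalculus.Spr (Cgh (m + 1) a) := ⟨_, _, half_pos hd, hC⟩
  have lg : Loc (gh₂ κ u) := ⟨u, u, _, 1, one_pos, biLoc_gh₂ κ u 1⟩
  have lG : ∀ (κ : Fin 4) (u : Fin 4 → ℤ), Loc (Lgh κ u) := fun κ u => ⟨u, u, _, _, by norm_num, biLoc_Lgh κ u⟩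
  have lR : ∀ (κ : Fin 4) (u : Fin 4 → ℤ), Loc (wR (m + 1) a κ u) := fun κ u => ⟨u, u, _, _, by linarith, hR κ u⟩
  have LM1 : Loc (comp (comp (comp lapU (Cgh (m + 1) a)) (gh₂ κ u)) (comp lapU (comp (Cgh (m + 1) a) lapU))) := (sA₁.comp_loc lg).comp_spr sA₃
  have LM4 : Loc (comp (comp (comp (comp lapU (Cgh (m + 1) a)) lapU) (gh₂ κ u)) (comp (Cgh (m + 1) a) lapU)) := (sA₄.comp_loc lg).comp_spr sA₂
  have LM2 : Loc (comp (comp (wR (m + 1) a κ u) (arr ((m + 1) * p) (ghCur l u'))) (comp (Cgh (m + 1) a) lapU)) := ((lR κ u).comp_spr (PeriodicArrays.spr_arr (biLoc_ghCur l u' 1) one_pos ((m + 1) * p))).comp_spr sA₂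
  have LM3 : Loc (comp (comp (wR (m + 1) a l u') (arr ((m + 1) * p) (ghCur κ u))) (comp (Cgh (m + 1) a) lapU)) := ((lR l u').comp_spr (PeriodicArrays.spr_arr (biLoc_ghCur κ u 1) one_pos ((m + 1) * p))).comp_spr sA₂
  have LM5 : Loc (comp (comp (comp (comp (comp lapU (Cgh (m + 1) a)) (Lgh κ u)) (Cgh (m + 1) a)) (arr ((m + 1) * p) (Lgh l u'))) (comp (Cgh (m + 1) a) lapU)) :=
    ((((sA₁.comp_loc (lG κ u)).comp_spr sC).comp_spr (PeriodicArrays.spr_arr (biLoc_Lgh l u') (by norm_num) ((m + 1) * p))).comp_spr sA₂)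
  have LM6 : Loc (comp (comp (comp (comp (comp lapU (Cgh (m + 1) a)) (Lgh l u')) (Cgh (m + 1) a)) (arr ((m + 1) * p) (Lgh κ u))) (comp (Cgh (m + 1) a) lapU)) :=
    ((((sA₁.comp_loc (lG l u')).comp_spr sC).comp_spr (PeriodicArrays.spr_arr (biLoc_Lgh κ u) (by norm_num) ((m + 1) * p))).comp_spr sA₂)
  have Lite : Loc (if (siteOf 4 ((m + 1) * p) u, κ) = (siteOf 4 ((m + 1) * p) u', l) then comp (comp (comp lapU (Cgh (m + 1) a)) (gh₂ κ u)) (comp lapU (comp (Cgh (m + 1) a) lapU)) + comp (comp (comp (comp lapU (Cgh (m + 1) a)) lapU) (gh₂ κ u)) (comp (Cgh (m + 1) a) lapU) else 0) := by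
    split_ifs
    · exact LM1.add LM4
    · exact ⟨u, u, 0, 1, one_pos, biLoc_zero_of_nonneg u u le_rfl 1⟩
  exact (((Lite.add LM2).add LM3).neg.add LM5).add LM6

/-- [folklore] **`W₄ = (arr K4)^`**: `M₀ᵀ · Ĉₛₜ · M₀ = (arr s (dSw (Z4 …)))^`. -/
theorem W4_eq_hat (ha : 0 < a) {N : Matrix (Site 4 ((m + 1) * p)) ρ ℝ}
    (hN : ∀ lam : Site 4 ((m + 1) * p) → ℝ, Shat m ((m + 1) * p) *ᵥ lam = 0 ↔ ∃ c : ρ → ℝ, lam = N *ᵥ c)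
    (hNinj : Function.Injective N.mulVec) :
    (Mjet₀ ((m + 1) * p))ᵀ * Cjet₁₁ ((m + 1) * p) (siteOf 4 ((m + 1) * p) u, κ) (siteOf 4 ((m + 1) * p) u', l) N * Mjet₀ ((m + 1) * p) = Matrix.of (periodiseF ((m + 1) * p) (toF (arr ((m + 1) * p) (K4 ((m + 1) * p) (m + 1) a κ u l u')))) := by
  obtain ⟨p₀, q₀, C, δ, hδ, hZ⟩ := loc_Z4 m p κ u l u' ha
  have e1 : (Mjet₀ ((m + 1) * p))ᵀ * Cjet₁₁ ((m + 1) * p) (siteOf 4 ((m + 1) * p) u, κ) (siteOf 4 ((m + 1) * p) u', l) N * Mjet₀ ((m + 1) * p) = Dhat 4 ((m + 1) * p) * (Lhat ((m + 1) * p) * Cjet₁₁ ((m + 1) * p) (siteOf 4 ((m + 1) * p) u, κ) (siteOf 4 ((m + 1) * p) u', l) N * Lhat ((m + 1) * p)) * (Dhat 4 ((m + 1) * p))ᵀ := by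
    simp only [Mjet₀, Matrix.transpose_mul, Matrix.transpose_transpose, Lhat_transpose, Matrix.mul_assoc]
  rw [e1, W4_site m p κ u l u' ha hN hNinj, Dhat_mul_perT_arr_mul_Dhat_transpose _ hZ hδ, K4]

/-- [folklore] `K4 = dSw Z4` is localised (every `s`; re-centred to a diagonal pair for the bond sandwich). -/
theorem loc_K4 (ha : 0 < a) : Loc (K4 ((m + 1) * p) (m + 1) a κ u l u') := by
  obtain ⟨p₀, q₀, C, δ, hδ, hZ⟩ := loc_Z4 m p κ u l u' ha
  exact ⟨p₀, p₀, _, δ, hδ, biLoc_dSw p₀ _ hδ.le (KernelWard.biLoc_recentre hZ hδ.le p₀ p₀)⟩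

end W4

end Summit.QuantumFields.BalabanUV.Beta.D1BFx.TorusWeightMixedTermW4

end
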